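import Summits.AtomisticToContinuum.HydrodynamicLimit.Theorems.ImplosionDichotomyHydroLimitInBandWindowContinuityStreaming
import Summits.AtomisticToContinuum.HydrodynamicLimit.Theorems.JParityClosureDensityCapMeanDisplacement
import HarnessLib

/-!
# Window continuity of the relative-entropy ledger, in band — kinematic lemmas
(helper of stub `stub_windowContinuityInBand`, line `IdeatorOneSketch`, crux `HydroLimitInBand`,
stmt-AtomisticToContinuum-9133)

Support file (`--supports stmt-AtomisticToContinuum-9133`). Small inputs of the one-window estimate
(`…WindowContinuityEstimate`): the logarithm is `m⁻¹`-Lipschitz on `[m, ∞)` (`abs_log_sub_log_le`); the total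
minimal-image displacement of the `N + 1` spheres along a good orbit over `[s, s']` is at most
`(s' − s)((N+1) + Σ_i |v_i|²)/2` (`sum_euclidDist_flow_le`, from the mean displacement bound `meanDisp_le_of_le` of the
tree, conservation of energy and `√x ≤ (1+x)/2`); and the streaming bound of `…WindowContinuityStreaming` is
a.e.-measurable in the initial datum (`aemeasurable_streamingBound`, through the jointly measurable modified flow).

References: H.-T. Yau, Lett. Math. Phys. 22 (1991) §2; I. Gallagher, L. Saint-Raymond, B. Texier, *From Newton to
Boltzmann* (2013) §1.1, §4.1.
-/

noncomputable section

open MeasureTheory Filter Set Topology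
open scoped ENNReal

namespace Summit.AtomisticToContinuum.HydrodynamicLimit.Theorems.HydroLimitInBandContinuity

open Literature.MathematicalPhysics.KineticTheory Literature.Analysis.FluidPDE
open Literature.Analysis.FunctionSpaces
open Summit.AtomisticToContinuum.HydrodynamicLimit.Theorems.BoltzmannGreenKuboOrthMomentum
  (flowMod measurable_flowMod flowMod_of_mem)
open Summit.AtomisticToContinuum.HydrodynamicLimit.Theorems.EntropyClockDock (ae_mem_good_localGibbsLaw)
open Summit.AtomisticToContinuum.HydrodynamicLimit.Theorems (meanDisp_le_of_le)

variable {σ : ℝ} {N : ℕ}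

/-- The logarithm is `m⁻¹`-Lipschitz on `[m, ∞)`, `m > 0`. [folklore] -/
theorem abs_log_sub_log_le {m a b : ℝ} (hm : 0 < m) (ha : m ≤ a) (hb : m ≤ b) :
    |Real.log a - Real.log b| ≤ m⁻¹ * |a - b| := by
  have ha0 : 0 < a := hm.trans_le ha
  have hb0 : 0 < b := hm.trans_le hb
  have key : ∀ {x y : ℝ}, 0 < x → m ≤ y → Real.log x - Real.log y ≤ m⁻¹ * |x - y| := by
    intro x y hx hy
    have hy0 : 0 < y := hm.trans_le hy
    have h1 : Real.log x - Real.log y ≤ (x - y) / y := by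
      rw [← Real.log_div hx.ne' hy0.ne']
      have := Real.log_le_sub_one_of_pos (div_pos hx hy0)
      rwa [div_sub_one hy0.ne'] at this
    have h2 : (x - y) / y ≤ m⁻¹ * |x - y| := by
      rw [div_eq_inv_mul]
      calc y⁻¹ * (x - y) ≤ y⁻¹ * |x - y| := mul_le_mul_of_nonneg_left (le_abs_self _) (inv_nonneg.2 hy0.le)
        _ ≤ m⁻¹ * |x - y| := mul_le_mul_of_nonneg_right (inv_anti₀ hm hy) (abs_nonneg _)
    exact h1.trans h2
  rw [abs_le]
  constructor
  · have h := key hb0 ha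
    rw [abs_sub_comm] at h
    linarith
  · exact key ha0 hb

/-- `√x ≤ (1 + x)/2` for `x ≥ 0`. [folklore] -/
theorem sqrt_le_half_one_add {x : ℝ} (hx : 0 ≤ x) : Real.sqrt x ≤ (1 + x) / 2 := by
  rw [Real.sqrt_le_left (by positivity)]
  nlinarith [sq_nonneg (x - 1)]

/-- **Total displacement along a good orbit.** Between times `s ≤ s'` the minimal-image displacements of the
`N + 1` spheres sum to at most `(s' − s) ((N+1) + Σ_i |v_i|²)/2` (mean displacement bound `meanDisp_le_of_le`,
conserved energy, `√x ≤ (1+x)/2`). [folklore] -/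
theorem sum_euclidDist_flow_le (Φ : HardSphereFlow (Torus.geometry (Fin 3)) (hsDiameter σ N) (N + 1))
    {z : Config (N + 1) (Fin 3) T3} (hz : z ∈ Φ.good) {s s' : ℝ} (hss' : s ≤ s') :
    ∑ i, Torus.euclidDist (Φ.flow s z i).1 (Φ.flow s' z i).1 ≤
      (s' - s) * ((((N : ℝ) + 1) + ∑ i, ‖(z i).2‖ ^ 2) / 2) := by
  have hN : (0 : ℝ) < (N : ℝ) + 1 := by positivity
  have h := meanDisp_le_of_le (Φ.isTrajectory z hz) hss'
  have hE : configEnergy (Φ.flow s z) = configEnergy z := by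
    have h' := IsHardSphereTrajectory.configEnergy_eq_holds (Φ.isTrajectory z hz) s 0
    rwa [Φ.flow_zero z hz] at h'
  rw [hE] at h
  have hcast : ((N + 1 : ℕ) : ℝ) = (N : ℝ) + 1 := by push_cast; ring
  rw [hcast] at h
  have hE0 : 0 ≤ configEnergy z := by unfold configEnergy; positivity
  have hsq : Real.sqrt (2 * (((N : ℝ) + 1)⁻¹ * configEnergy z)) ≤ (1 + 2 * (((N : ℝ) + 1)⁻¹ * configEnergy z)) / 2 :=
    sqrt_le_half_one_add (by positivity)
  have hsum : ∑ i, Torus.euclidDist (Φ.flow s' z i).1 (Φ.flow s z i).1 ≤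
      ((N : ℝ) + 1) * (Real.sqrt (2 * (((N : ℝ) + 1)⁻¹ * configEnergy z)) * (s' - s)) := by
    rw [← div_le_iff₀' hN, div_eq_inv_mul]
    exact h
  have hcomm : ∑ i, Torus.euclidDist (Φ.flow s z i).1 (Φ.flow s' z i).1 =
      ∑ i, Torus.euclidDist (Φ.flow s' z i).1 (Φ.flow s z i).1 :=
    Finset.sum_congr rfl fun i _ => Torus.euclidDist_comm _ _
  have h2E : ∑ i, ‖(z i).2‖ ^ 2 = 2 * configEnergy z := by unfold configEnergy; ring
  rw [hcomm, h2E]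
  calc ∑ i, Torus.euclidDist (Φ.flow s' z i).1 (Φ.flow s z i).1
      ≤ ((N : ℝ) + 1) * (Real.sqrt (2 * (((N : ℝ) + 1)⁻¹ * configEnergy z)) * (s' - s)) := hsum
    _ ≤ ((N : ℝ) + 1) * ((1 + 2 * (((N : ℝ) + 1)⁻¹ * configEnergy z)) / 2 * (s' - s)) := by
        gcongr
    _ = (s' - s) * ((((N : ℝ) + 1) + 2 * configEnergy z) / 2) := by
        field_simp

variable {a₀ θ₀ : T3 → ℝ} {u₀ : T3 → V3}

/-- The streaming bound `z ↦ ∫_s^{s'} K Σ_i (1 + |v_i(r)|³) dr` is a.e.-measurable under the local Gibbs law (it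
agrees on the good set with a lower integral of the jointly measurable modified flow). [folklore] -/
theorem aemeasurable_streamingBound (Φ : HardSphereFlow (Torus.geometry (Fin 3)) (hsDiameter σ N) (N + 1))
    {K : ℝ} (hK0 : 0 ≤ K) {s s' : ℝ} (hss' : s ≤ s') :
    AEMeasurable (fun z => ENNReal.ofReal (∫ r in s..s', K * ∑ i, (1 + ‖(Φ.flow r z i).2‖ ^ 3)))
      (localGibbsLaw σ a₀ u₀ θ₀ N Φ) := by
  set F : Config (N + 1) (Fin 3) T3 × ℝ → ℝ≥0∞ := fun p =>
    ENNReal.ofReal (K * ∑ i, (1 + ‖(flowMod Φ (p.2, p.1) i).2‖ ^ 3)) with hF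
  have hFm : Measurable F := by
    refine (measurable_const.mul (Finset.measurable_sum _ fun i _ => measurable_const.add ?_)).ennreal_ofReal
    exact (((measurable_pi_apply i).comp ((measurable_flowMod Φ).comp
      (measurable_snd.prodMk measurable_fst))).snd.norm.pow_const 3)
  refine ⟨fun z => ∫⁻ r in Ioc s s', F (z, r), hFm.lintegral_prod_right', ?_⟩
  filter_upwards [ae_mem_good_localGibbsLaw σ a₀ θ₀ u₀ N Φ] with z hz
  rw [intervalIntegral.integral_of_le hss',
    ofReal_integral_eq_lintegral_ofReal (integrableOn_cubicSum Φ hz K s s')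
      (ae_of_all _ fun r => mul_nonneg hK0 (Finset.sum_nonneg fun i _ => by positivity))]
  refine lintegral_congr fun r => ?_
  simp only [hF, flowMod_of_mem Φ hz]

end Summit.AtomisticToContinuum.HydrodynamicLimit.Theorems.HydroLimitInBandContinuity

end
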